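import Summits.BirchSwinnertonDyer.BirchSwinnertonDyer.Theorems.ThetaPartnerAtTwoSignedKatoUpToAtTwoKatoBKLambdaFreeValues
import Summits.BirchSwinnertonDyer.BirchSwinnertonDyer.Theorems.ThetaPartnerAtTwoSignedKatoUpToAtTwoKatoBKLambdaFreeCharValues
import Summits.BirchSwinnertonDyer.BirchSwinnertonDyer.Theorems.ThetaPartnerAtTwoSignedKatoUpToAtTwoKatoBKLambdaFreeESClass
import HarnessLib

/-!
# Route `ThetaPartnerAtTwo` (TP2), crux K3 `SignedKatoDivisibilityUpToAtTwo` (stmt-BirchSwinnertonDyer-20308 / K3P′ 25631), line `colemanrat`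
# v14.1 — THE SOCKET over the Λ-FREE residue CORE_KZ⁰ («Kato's Euler system (C1)(C2) with values (C5) at the standard complex embeddings ∧
# the layer Tate pairing of `Cor z_{2^{n+2}}` with formal points is `Tr_{K_{n+2}/ℚ₂}(log_ω Q · x_{n+2})`») ⟹ CORE_pairχ^prim; re-cut of p636266

Width seat `bsd-wall-tp2-p2x-w2` g8 (cell `bsd-wall`). CORE_KZ⁰ is w3 g8's CORE_KZ (hypothesis of `corePairChiPrim_of_coreKZ_of_bricks`, p636266)
with «∃ ΛK, … ZetaBody W 2 f ιC κK ΛK c d a A z x ∧ (KZ)» REPLACED by «… (C1) ∧ (C2) ∧ (C5) ∧ (KZ)» — the three conjuncts of `ZetaBody` the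
socket consumes, VERBATIM, and NO dual-exponential datum `Λ` (so Kato's abstract `exp*`-datum and its two own-attribution axioms (C3a)/(C3b),
and (C4), leave the displayed residue; audit in `…KatoBKLambdaFree{Values,CharValues,ESClass}`). CORE_KZ ⟹ CORE_KZ⁰ (forgetful). Proof =
p636266 verbatim with the four `ZetaBody` consumers replaced by their Λ-free twins; brick B4c is no longer displayed but called
(`katoTrivialValuesTwo_brick_of_valueLaw`). HONEST FRAMING: theorems only (no definition, no named fact, no instance, no `sorry`); closes no
item; K3 / K3P′ NOT settled; BSD is NOT proved by any of this.
-/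

set_option autoImplicit false
-- the Theorems namespace of this sub repeats the summit name by design (D-0017 nested layout)
set_option linter.dupNamespace false

noncomputable section

set_option backward.isDefEq.respectTransparency false

open scoped Classical MatrixGroups ModularForm NumberField TensorProduct

open CongruenceSubgroup WeierstrassCurve Field IsDedekindDomain NumberField
  Literature.NumberTheory.GaloisRepresentations
  Literature.NumberTheory.EllipticCurves Literature.NumberTheory.EllipticCurves.ModularForms
  Literature.NumberTheory.EllipticCurves.Module Literature.NumberTheory.EllipticCurves.Rank1Residual
  Literature.NumberTheory.EllipticCurves.Kobayashi2003 Literature.NumberTheory.EllipticCurves.Kato2004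
  Literature.NumberTheory.EllipticCurves.Kato2004.EulerSystemValues Literature.NumberTheory.EllipticCurves.GreenbergSelmer
  Literature.NumberTheory.EllipticCurves.Sprung2012
  Literature.NumberTheory.EllipticCurves.FormalGroupChart
  ZpExtension Summit.BirchSwinnertonDyer.Rank1Residual.Supersingular
  Summit.BirchSwinnertonDyer.Rank1Residual.Additive Summit.BirchSwinnertonDyer.Rank1Residual.Additive.PadicCyclotomicTower
  Summit.BirchSwinnertonDyer.Rank1Residual.Additive.BallEval
  Summit.BirchSwinnertonDyer.BirchSwinnertonDyer.Theorems.SignedKatoOffTwo.LocalTwo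

open Rat.HeightOneSpectrum (primesEquiv)

namespace Summit.BirchSwinnertonDyer.BirchSwinnertonDyer.Theorems.SignedKatoOffTwo.KatoBK

set_option maxHeartbeats 400000 in
/-- **CORE_KZ⁰ ⟹ CORE_pairχ^prim over the displayed kernel bricks** B1 (cusp element `μ̃ ∉ 𝔭`), B4a (Hecke at `2`), B4b (base-case logs
`−2`, `8`) — re-cut of p636266 over the Λ-free residue: Kato's Euler system (C1)(C2), values (C5), and the layer Tate pairing of `Cor z_{2^{n+2}}`
against formal points = trace of `log_ω Q · x_{n+2}`; `ν := C(D·q_den)`, `μ := C(3 q_num)·μ̃`, class `s` = Λ-adic lift of the `2`-power line.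
[cite: Kato2004Asterisque, Thm. 12.5 (1), Ex. 13.3, §13.12] [cite: Kobayashi2003, (8.23), Prop. 8.25–8.26, proof of Thm. 6.3 (p. 25)]
[cite: BlochKato1990, §3 (3.10.1), (3.11.1)] -/
theorem corePairChiPrim_of_coreKZ0_of_bricks
    (hKZ :
      ∀ (v : HeightOneSpectrum (𝓞 ℚ)), ((2 : ℕ) : 𝓞 ℚ) ∈ v.asIdeal →
      ∀ (W : WeierstrassCurve ℚ) [W.IsElliptic] [W.IsGloballyMinimal],
        ¬ W.HasCM → W.analyticRank = 0 → GoodSS W 2 → W.frobeniusTrace 2 = 0 →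
        ∀ (κ : ZpExtension ℚ 2) (γ : Field.absoluteGaloisGroup ℚ) (hκ : κ.IsCyclotomic),
          κ.IsTopGenerator γ → IsCyclotomicVariable 2 γ →
          ∀ [NeZero (W.conductorNorm ℤ)] (f : CuspForm (Gamma0 (W.conductorNorm ℤ)) 2),
            IsNewformOf W f → ∀ (ϖ : ℚ), (ϖ : ℝ) * W.realPeriodRat = plusPeriod f →
          ∀ (Lplus Lminus : IwasawaAlgebra 2), IsPollackPair f 2 Lplus Lminus →
          ∀ [ContinuousSMul ℤ_[2] (W.tateModule 2)] [Module.Free ℤ_[2] (W.tateModule 2)]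
            [Module.Finite ℤ_[2] (W.tateModule 2)],
          ∀ (pair : ∀ n : ℕ, H1 (tateRep W 2) (κ.layerSubgroup n) →ₗ[ℤ_[2]]
              (localLayerPointsOfEmb κ (closureEmb (K := ℚ) (v.adicCompletion ℚ)) W n →+ ℤ_[2])),
            (∀ (n : ℕ) (x : H1 (tateRep W 2) (κ.layerSubgroup (n + 1))) (Q : localPoints W (v.adicCompletion ℚ))
              (hQ : Q ∈ localLayerPointsOfEmb κ (closureEmb (K := ℚ) (v.adicCompletion ℚ)) W n),
              pair n (layerCores (tateRep W 2) κ n x) ⟨Q, hQ⟩ =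
                pair (n + 1) x ⟨Q, localLayerPointsOfEmb_mono κ (closureEmb (K := ℚ) (v.adicCompletion ℚ)) W (Nat.le_succ n) hQ⟩) →
            (∀ (n : ℕ) (g : absoluteGaloisGroup (v.adicCompletion ℚ)) (y : H1 (tateRep W 2) (κ.layerSubgroup n))
              (Q : localPoints W (v.adicCompletion ℚ))
              (hQ : Q ∈ localLayerPointsOfEmb κ (closureEmb (K := ℚ) (v.adicCompletion ℚ)) W n),
              pair n (conjMap (tateRep W 2).toTopRep (κ.layerSubgroup n) (resGalOfEmb (closureEmb (K := ℚ) (v.adicCompletion ℚ)) g) 1 y)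
                ⟨g • Q, smul_mem_localLayerPointsOfEmb κ (closureEmb (K := ℚ) (v.adicCompletion ℚ)) W n g hQ⟩ = pair n y ⟨Q, hQ⟩) →
            (∀ (n k : ℕ) (x : H1 (tateRep W 2) (κ.layerSubgroup n))
              (Q : localLayerPointsOfEmb κ (closureEmb (K := ℚ) (v.adicCompletion ℚ)) W n),
              PadicInt.toZModPow k (pair n x Q) =
                LayerPairing.layerPairingPk W κ v (LayerPairing.weilTowerPk W) (LayerPairing.weilTowerPk_pow W)
                  (LayerPairing.weilTowerPk_add_left W) (LayerPairing.weilTowerPk_add_right W) (LayerPairing.weilTowerPk_smul W)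
                  n k x Q) →
          ∀ (Φ : AlgebraicClosure ℚ_[2] ≃ₐ[ℚ] AlgebraicClosure (v.adicCompletion ℚ)) (φ : ℚ_[2] ≃+* v.adicCompletion ℚ),
            (∀ y : ℚ_[2], Φ (algebraMap ℚ_[2] (AlgebraicClosure ℚ_[2]) y) =
              algebraMap (v.adicCompletion ℚ) (AlgebraicClosure (v.adicCompletion ℚ)) (φ y)) →
          ∀ (ι : AlgebraicClosure ℚ →ₐ[ℚ] AlgebraicClosure ℚ_[2]),
            (∀ z, closureEmb (K := ℚ) (v.adicCompletion ℚ) z = Φ (ι z)) →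
          ∀ (e : ∀ k : ℕ, CyclotomicField (cycLevel 2 k ∅) ℚ →ₐ[ℚ] PadicAlgCl 2),
            (∀ k, e k (IsCyclotomicExtension.zeta (cycLevel 2 k ∅) ℚ (CyclotomicField (cycLevel 2 k ∅) ℚ)) = zeta 2 k) →
          ∀ (τ : ∀ m : ℕ, ZMod (2 ^ m) → Field.absoluteGaloisGroup ℚ_[2]),
            (∀ (m : ℕ) (a : ZMod (2 ^ m)), IsUnit a → τ m a • zeta 2 m = zeta 2 m ^ a.val) →
          ∀ (ιC : (m : ℕ) → (CyclotomicField m ℚ →+* ℂ)),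
          (∀ k : ℕ, ιC (cycLevel 2 k ∅) (IsCyclotomicExtension.zeta (cycLevel 2 k ∅) ℚ (CyclotomicField (cycLevel 2 k ∅) ℚ)) =
            Complex.exp (2 * Real.pi * Complex.I / (cycLevel 2 k ∅ : ℕ))) →
          ∃ κK : ℝ, κK ≠ 0 ∧
            ∀ (c d a : ℤ) (A : ℕ), 0 < A → Int.gcd c (6 * 2 * A) = 1 → Int.gcd d (6 * 2 * W.conductorNorm ℤ) = 1 →
              ∃ (z : ∀ (k : ℕ) (r : (cyclotomicLevelsRat 2 (badPlaces c d A (W.conductorNorm ℤ))).Ideals),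
                    H1 (tateRep W 2) ((cyclotomicLevelsRat 2 (badPlaces c d A (W.conductorNorm ℤ))).level k r.1))
                (x : ∀ (k : ℕ) (r : (cyclotomicLevelsRat 2 (badPlaces c d A (W.conductorNorm ℤ))).Ideals),
                    CyclotomicField (cycLevel 2 k r.1) ℚ),
                IsEulerSystem (cyclotomicLevelsRat 2 (badPlaces c d A (W.conductorNorm ℤ))) (tateRep W 2) 2 z ∧
                (∀ (k : ℕ) (r : (cyclotomicLevelsRat 2 (badPlaces c d A (W.conductorNorm ℤ))).Ideals) (v : HeightOneSpectrum (𝓞 ℚ)),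
                  ((primesEquiv v : Nat.Primes) : ℕ) ≠ 2 →
                  ∀ 𝔓 ∈ v.primesAbove,
                    resLe (tateRep W 2).toTopRep
                        (inf_le_left : (cyclotomicLevelsRat 2 (badPlaces c d A (W.conductorNorm ℤ))).level k r.1 ⊓ 𝔓.inertia (absoluteGaloisGroup ℚ) ≤
                          (cyclotomicLevelsRat 2 (badPlaces c d A (W.conductorNorm ℤ))).level k r.1)
                        1 (z k r) = 0) ∧
                (∀ (k : ℕ) (r : (cyclotomicLevelsRat 2 (badPlaces c d A (W.conductorNorm ℤ))).Ideals) (d' : ℤ)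
                    (χ : DirichletCharacter ℂ (cycLevel 2 k r.1)) (Lχ : ℂ → ℂ),
                  Int.gcd (c * d) (cycLevel 2 k r.1 * A) = 1 →
                  d * d' ≡ 1 [ZMOD (A : ℤ)] →
                  IsDepletedTwistedL f (cycLevel 2 k r.1) (2 * A) χ Lχ →
                    (χ (-1) = 1 →
                      charSum (cycLevel 2 k r.1) (ιC (cycLevel 2 k r.1)) χ (x k r) =
                        (κK : ℂ) * (Lχ 1 / (plusPeriod f : ℂ)) *
                          cuspFactor f true (fun n ↦ χ⁻¹ (n : ZMod (cycLevel 2 k r.1))) c d a A d') ∧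
                    (χ (-1) = -1 →
                      charSum (cycLevel 2 k r.1) (ιC (cycLevel 2 k r.1)) χ (x k r) =
                        -(κK : ℂ) * (Lχ 1 / (Complex.I * (minusPeriod f : ℂ))) *
                          cuspFactor f false (fun n ↦ χ⁻¹ (n : ZMod (cycLevel 2 k r.1))) c d a A d')) ∧
                (haveI := isIntegral_genFib_baseChange 2 ((integralModelInt W).map (Int.castRingHom ℤ_[2]))
                 ∀ (n : ℕ) (Q₀ : localPoints W ℚ_[2])
                  (hQv : WeierstrassCurve.Affine.Point.map (W' := W)
                      (Φ : AlgebraicClosure ℚ_[2] →ₐ[ℚ] AlgebraicClosure (v.adicCompletion ℚ))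
                      (show (W.baseChange (AlgebraicClosure ℚ_[2])).toAffine.Point from Q₀) ∈
                    localLayerPointsOfEmb κ (closureEmb (K := ℚ) (v.adicCompletion ℚ)) W n),
                  (toLoc ((genFibΩ_eq_baseChange ((integralModelInt W).map (Int.castRingHom ℤ_[2]))).trans
                    (baseChange_twoAdicModel W))).symm Q₀ ∈
                    kernel (Valued.v (R := PadicAlgCl 2)) (genFibΩ 2 ((integralModelInt W).map (Int.castRingHom ℤ_[2]))) →
                  algebraMap ℚ_[2] (PadicAlgCl 2)
                      ((pair n (levelToLayerTwo W hκ (∅ : Set (HeightOneSpectrum (𝓞 ℚ))) n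
                          (z (n + 2) (cyclotomicLevelsRat 2 (badPlaces c d A (W.conductorNorm ℤ))).idealOne))
                        ⟨_, hQv⟩ : ℤ_[2]) : ℚ_[2]) =
                    ∑ b : (ZMod (2 ^ (n + 2)))ˣ, τ (n + 2) (b : ZMod (2 ^ (n + 2))) •
                      (ptLogΩ 2 ((integralModelInt W).map (Int.castRingHom ℤ_[2]))
                          ((toLoc ((genFibΩ_eq_baseChange ((integralModelInt W).map (Int.castRingHom ℤ_[2]))).trans
                            (baseChange_twoAdicModel W))).symm Q₀) *
                        e (n + 2) (x (n + 2) (cyclotomicLevelsRat 2 (badPlaces c d A (W.conductorNorm ℤ))).idealOne))))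
    (hB1 : ∀ {N : ℕ} [NeZero N] (f : CuspForm (Gamma0 N) 2), IsNewform0 f → coeffField f = ⊥ → ¬ 2 ∣ N →
      ∀ 𝔭 : PrimeSpectrum (IwasawaAlgebra 2), 𝔭.asIdeal.height = 1 → PowerSeries.C (2 : ℤ_[2]) ∉ 𝔭.asIdeal →
      ∃ (c d a : ℤ) (ee : ℕ) (d' D : ℤ) (μt : IwasawaAlgebra 2),
        Int.gcd c (6 * 2 * 2 ^ ee) = 1 ∧ Int.gcd d (6 * 2 * N) = 1 ∧ d * d' ≡ 1 [ZMOD ((2 ^ ee : ℕ) : ℤ)] ∧ D ≠ 0 ∧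
        μt ∉ 𝔭.asIdeal ∧
        ∀ (n : ℕ) (χ : DirichletCharacter ℂ_[2] (2 ^ (n + 2))), χ.Even → (∃ j : ℕ, orderOf χ = 2 ^ j) →
          HasSum (fun k ↦ ((algebraMap ℚ_[2] ℂ_[2]).comp (algebraMap ℤ_[2] ℚ_[2])) (PowerSeries.coeff k μt) *
              (χ (5 : ZMod (2 ^ (n + 2))) - 1) ^ k)
            ((D : ℂ_[2]) * ((c : ℂ_[2]) ^ 2 * (d : ℂ_[2]) ^ 2 * ((ratMinusSymbol f ((a : ℚ) / (2 ^ ee : ℕ)) : ℚ) : ℂ_[2])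
              - (c : ℂ_[2]) * (d : ℂ_[2]) ^ 2 * χ (c : ZMod (2 ^ (n + 2))) *
                  ((ratMinusSymbol f ((a * c : ℚ) / (2 ^ ee : ℕ)) : ℚ) : ℂ_[2])
              - (c : ℂ_[2]) ^ 2 * (d : ℂ_[2]) * χ (d : ZMod (2 ^ (n + 2))) *
                  ((ratMinusSymbol f ((a * d' : ℚ) / (2 ^ ee : ℕ)) : ℚ) : ℂ_[2])
              + (c : ℂ_[2]) * (d : ℂ_[2]) * (χ (c : ZMod (2 ^ (n + 2))) * χ (d : ZMod (2 ^ (n + 2)))) *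
                  ((ratMinusSymbol f ((a * c * d' : ℚ) / (2 ^ ee : ℕ)) : ℚ) : ℂ_[2]))))
    (hB4a : ∀ {N : ℕ} [NeZero N] (f : CuspForm (Gamma0 N) 2), IsNewform0 f → coeffField f = ⊥ → ¬ 2 ∣ N →
      cuspCoeff f 2 = 0 →
      ratTwistedSymbolSum f (1 : DirichletCharacter ℂ_[2] (2 ^ (0 + 2))) = ((-(ratPlusSymbol f 0) : ℚ) : ℂ_[2]) ∧
      ratTwistedSymbolSum f (1 : DirichletCharacter ℂ_[2] (2 ^ (1 + 2))) = ((4 * ratPlusSymbol f 0 : ℚ) : ℂ_[2]))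
    (hB4b : ∀ (W : WeierstrassCurve ℚ) [W.IsElliptic] [W.IsGloballyMinimal]
      {c : ℕ → localPoints W ℚ_[2]} {σ : ℕ → Field.absoluteGaloisGroup ℚ_[2]} {d : ℕ → localPoints W ℚ_[2]},
      (haveI := isIntegral_genFib_baseChange 2 ((integralModelInt W).map (Int.castRingHom ℤ_[2]))
        ∀ m, (toLoc ((genFibΩ_eq_baseChange ((integralModelInt W).map (Int.castRingHom ℤ_[2]))).trans
              (baseChange_twoAdicModel W))).symm (c m) ∈
            subfieldPoints (genFibΩ 2 ((integralModelInt W).map (Int.castRingHom ℤ_[2]))) (layer 2 m).toSubfield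
              coeffs_mem_layer ∧
          (toLoc ((genFibΩ_eq_baseChange ((integralModelInt W).map (Int.castRingHom ℤ_[2]))).trans
              (baseChange_twoAdicModel W))).symm (c m) ∈
            kernel (Valued.v (R := PadicAlgCl 2)) (genFibΩ 2 ((integralModelInt W).map (Int.castRingHom ℤ_[2]))) ∧
          ptLogΩ 2 ((integralModelInt W).map (Int.castRingHom ℤ_[2]))
            ((toLoc ((genFibΩ_eq_baseChange ((integralModelInt W).map (Int.castRingHom ℤ_[2]))).trans
              (baseChange_twoAdicModel W))).symm (c m)) = ell 2 m) →
      (∀ m, 1 ≤ m → σ m • zeta 2 m = (zeta 2 m)⁻¹) →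
      (∀ n, d n = 3 • (c (n + 2) + σ (n + 2) • c (n + 2)) - 2 • c 1) →
      ∀ (n : ℕ), n ≤ 1 → ∀ {g₀ : Field.absoluteGaloisGroup ℚ_[2]}, g₀ • zeta 2 (n + 2) = zeta 2 (n + 2) ^ 5 →
      haveI := isIntegral_genFib_baseChange 2 ((integralModelInt W).map (Int.castRingHom ℤ_[2]))
      ∑ j ∈ Finset.range (2 ^ n), ptLogΩ 2 ((integralModelInt W).map (Int.castRingHom ℤ_[2]))
          ((toLoc ((genFibΩ_eq_baseChange ((integralModelInt W).map (Int.castRingHom ℤ_[2]))).trans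
            (baseChange_twoAdicModel W))).symm (g₀ ^ j • d n)) =
        ((if n = 0 then (-2 : ℚ) else 8 : ℚ) : PadicAlgCl 2)) :
    ∀ (v : HeightOneSpectrum (𝓞 ℚ)), ((2 : ℕ) : 𝓞 ℚ) ∈ v.asIdeal →
    ∀ (W : WeierstrassCurve ℚ) [W.IsElliptic] [W.IsGloballyMinimal],
      ¬ W.HasCM → W.analyticRank = 0 → GoodSS W 2 → W.frobeniusTrace 2 = 0 →
      ∀ (κ : ZpExtension ℚ 2) (γ : Field.absoluteGaloisGroup ℚ) (hκ : κ.IsCyclotomic),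
        κ.IsTopGenerator γ → IsCyclotomicVariable 2 γ →
        ∀ [NeZero (W.conductorNorm ℤ)] (f : CuspForm (Gamma0 (W.conductorNorm ℤ)) 2),
          IsNewformOf W f → ∀ (ϖ : ℚ), (ϖ : ℝ) * W.realPeriodRat = plusPeriod f →
        ∀ (Lplus Lminus : IwasawaAlgebra 2), IsPollackPair f 2 Lplus Lminus →
        ∀ [ContinuousSMul ℤ_[2] (W.tateModule 2)] [Module.Free ℤ_[2] (W.tateModule 2)]
          [Module.Finite ℤ_[2] (W.tateModule 2)],
        ∀ 𝔭 : PrimeSpectrum (IwasawaAlgebra 2), 𝔭.asIdeal.height = 1 →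
          PowerSeries.C (2 : ℤ_[2]) ∉ 𝔭.asIdeal →
        ∀ (I : Kato2004.IwasawaH1Data W 2 κ γ)
          (pair : ∀ n : ℕ, H1 (tateRep W 2) (κ.layerSubgroup n) →ₗ[ℤ_[2]]
            (localLayerPointsOfEmb κ (closureEmb (K := ℚ) (v.adicCompletion ℚ)) W n →+ ℤ_[2])),
          (∀ (n : ℕ) (x : H1 (tateRep W 2) (κ.layerSubgroup (n + 1))) (Q : localPoints W (v.adicCompletion ℚ))
            (hQ : Q ∈ localLayerPointsOfEmb κ (closureEmb (K := ℚ) (v.adicCompletion ℚ)) W n),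
            pair n (layerCores (tateRep W 2) κ n x) ⟨Q, hQ⟩ =
              pair (n + 1) x ⟨Q, localLayerPointsOfEmb_mono κ (closureEmb (K := ℚ) (v.adicCompletion ℚ)) W (Nat.le_succ n) hQ⟩) →
          (∀ (n : ℕ) (g : absoluteGaloisGroup (v.adicCompletion ℚ)) (y : H1 (tateRep W 2) (κ.layerSubgroup n))
            (Q : localPoints W (v.adicCompletion ℚ))
            (hQ : Q ∈ localLayerPointsOfEmb κ (closureEmb (K := ℚ) (v.adicCompletion ℚ)) W n),
            pair n (conjMap (tateRep W 2).toTopRep (κ.layerSubgroup n) (resGalOfEmb (closureEmb (K := ℚ) (v.adicCompletion ℚ)) g) 1 y)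
              ⟨g • Q, smul_mem_localLayerPointsOfEmb κ (closureEmb (K := ℚ) (v.adicCompletion ℚ)) W n g hQ⟩ = pair n y ⟨Q, hQ⟩) →
          (∀ (n k : ℕ) (x : H1 (tateRep W 2) (κ.layerSubgroup n))
            (Q : localLayerPointsOfEmb κ (closureEmb (K := ℚ) (v.adicCompletion ℚ)) W n),
            PadicInt.toZModPow k (pair n x Q) =
              LayerPairing.layerPairingPk W κ v (LayerPairing.weilTowerPk W) (LayerPairing.weilTowerPk_pow W)
                (LayerPairing.weilTowerPk_add_left W) (LayerPairing.weilTowerPk_add_right W) (LayerPairing.weilTowerPk_smul W)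
                n k x Q) →
        ∃ (g : absoluteGaloisGroup (v.adicCompletion ℚ))
          (_ : κ.IsTopGenerator (resGalOfEmb (closureEmb (K := ℚ) (v.adicCompletion ℚ)) g))
          (d : ℕ → localPoints W (v.adicCompletion ℚ)) (s : I.H),
          (∀ n, d n ∈ localLayerPointsOfEmb κ (closureEmb (K := ℚ) (v.adicCompletion ℚ)) W n) ∧
          (∀ n, localTraceOfEmb κ (closureEmb (K := ℚ) (v.adicCompletion ℚ)) W (n + 1) (n + 2) (d (n + 2)) = -d n) ∧
          (∀ n : ℕ, 1 ≤ n → ∀ P ∈ localLayerPointsOfEmb κ (closureEmb (K := ℚ) (v.adicCompletion ℚ)) W n,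
            ∃ B ∈ AddSubgroup.closure (Set.range fun σ : absoluteGaloisGroup (v.adicCompletion ℚ) ↦ σ • d n),
              ∃ P' ∈ localLayerPointsOfEmb κ (closureEmb (K := ℚ) (v.adicCompletion ℚ)) W (n - 1),
              ∃ R ∈ localLayerPointsOfEmb κ (closureEmb (K := ℚ) (v.adicCompletion ℚ)) W n, P = B + P' + 2 • R) ∧
          (∀ P ∈ localLayerPointsOfEmb κ (closureEmb (K := ℚ) (v.adicCompletion ℚ)) W 0,
            ∃ a : ℤ, ∃ R ∈ localLayerPointsOfEmb κ (closureEmb (K := ℚ) (v.adicCompletion ℚ)) W 0, P = a • d 0 + 2 • R) ∧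
          Kato2004.IsEulerSystemClassTwo W hκ I s ∧
          ∃ μ ν : IwasawaAlgebra 2, μ ∉ 𝔭.asIdeal ∧ ν ∉ 𝔭.asIdeal ∧
            ∀ (n : ℕ) (χ : DirichletCharacter ℂ_[2] (2 ^ (n + cyclotomicExponent 2))),
              χ.Even → (∃ j : ℕ, orderOf χ = 2 ^ j) → (χ.IsPrimitive ∨ n ≤ 1) →
              (∑' k, ((algebraMap ℚ_[2] ℂ_[2]).comp (algebraMap ℤ_[2] ℚ_[2])) (PowerSeries.coeff k ν) *
                  (χ (cyclotomicGenerator 2 : ZMod (2 ^ (n + cyclotomicExponent 2))) - 1) ^ k) *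
                (∑' k, ((algebraMap ℚ_[2] ℂ_[2]).comp (algebraMap ℤ_[2] ℚ_[2]))
                    (PowerSeries.coeff k (pairingSum W (localLayerPointsOfEmb κ (closureEmb (K := ℚ) (v.adicCompletion ℚ)) W n)
                      g n (d n) (pair n (I.proj n s)))) *
                  (χ (cyclotomicGenerator 2 : ZMod (2 ^ (n + cyclotomicExponent 2))) - 1) ^ k) =
              (∑' k, ((algebraMap ℚ_[2] ℂ_[2]).comp (algebraMap ℤ_[2] ℚ_[2])) (PowerSeries.coeff k μ) *
                  (χ (cyclotomicGenerator 2 : ZMod (2 ^ (n + cyclotomicExponent 2))) - 1) ^ k) *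
                ratTwistedSymbolSum f χ := by
  intro v hv W _ _ hcm hr hss ha κ γ hκ hγ hvar _ f hf ϖ hϖ Lplus Lminus hPol _ _ _ 𝔭 h𝔭 h2 I pair hP1 hP2 hP3
  have hf0 : IsNewform0 f := hf.1
  have hQ : coeffField f = ⊥ := hf.coeffField_eq_bot
  have hN2 : ¬ 2 ∣ W.conductorNorm ℤ := not_dvd_level_of_isNewformOf hf hss.1
  have hap : cuspCoeff f 2 = 0 := by
    rw [cuspCoeff_eq_frobeniusTrace_of_isNewformOf_holds hf hss.1, ha]; simp
  have hv' : (2 : 𝓞 ℚ) ∈ v.asIdeal := by exact_mod_cast hv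
  obtain ⟨Φ, φ, hΦφ, ι, hι, cc, σσ, d₀, d, hcΩ, hcstab, hσσ, hd₀, hd₀L, hdT, hL, hTR, hGEN, hGEN0⟩ := SignedEC.PlusLayer.plusHondaSystemTwo_adicCompletion_withLog W hss ha κ hκ v hv'
  obtain ⟨g₀, g, -, -, hgen, -, -, hζpow, -, hTg⟩ := LocalVar.exists_localVariable_two hκ hγ hvar v Φ φ hΦφ ι hι
  obtain ⟨e, he⟩ := exists_algHom_cyclotomicField_zeta_eq
  obtain ⟨τ, hτ⟩ := exists_tau_two
  obtain ⟨ιC, hιC⟩ := exists_ringHom_cyclotomicField_complex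
  obtain ⟨κK, hκK, hKZ'⟩ := hKZ v hv W hcm hr hss ha κ γ hκ hγ hvar f hf ϖ hϖ Lplus Lminus hPol pair hP1 hP2 hP3 Φ φ hΦφ ι hι e he τ hτ ιC hιC
  obtain ⟨q, hq⟩ := KatoConst.exists_ratCast_eq_katoConstant_of_analyticRank_eq_zero_of_valueLaw (ι := ιC) (κ := κK) hf hr 2
    fun c d a A hA hc hd ↦ by obtain ⟨z, x, -, -, h5, -⟩ := hKZ' c d a A hA hc hd; exact ⟨x, h5⟩
  have hq0 : q ≠ 0 := by rintro rfl; exact hκK (by exact_mod_cast hq)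
  obtain ⟨c, dd, a, ee, d', D, μt, hgc, hgd, hdd', hD, hμt, hμteval⟩ := hB1 f hf0 hQ hN2 𝔭 h𝔭 h2
  obtain ⟨z, x, hC1, hC2, hC5, hADJ⟩ := hKZ' c dd a (2 ^ ee) (pow_pos two_pos ee) hgc hgd
  have hne := level_ne_zero (W.conductorNorm ℤ) ee hgc hgd
  obtain ⟨s, hES, hs⟩ := exists_isEulerSystemClassTwo_of_isEulerSystem W hκ I hC1 hC2 hne
  refine ⟨g, hgen, d, s, hL, hTR, hGEN, hGEN0, hES, PowerSeries.C (((3 * q.num : ℤ) : ℤ_[2])) * μt,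
    PowerSeries.C (((D * q.den : ℤ) : ℤ_[2])), ?_, ?_, ?_⟩
  · -- `μ ∉ 𝔭`
    intro hmem
    rcases 𝔭.isPrime.mem_or_mem hmem with h | h
    · exact C_intCast_not_mem_of_ne_zero 𝔭.isPrime h2 (by
        have : q.num ≠ 0 := Rat.num_ne_zero.mpr hq0
        positivity) h
    · exact hμt h
  · -- `ν ∉ 𝔭`
    exact C_intCast_not_mem_of_ne_zero 𝔭.isPrime h2 (by
      have : (q.den : ℤ) ≠ 0 := by exact_mod_cast q.den_ne_zero
      exact mul_ne_zero hD this)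
  have hce : cyclotomicExponent 2 = 2 := rfl
  have hcg5 : cyclotomicGenerator 2 = 5 := rfl
  intro n
  rw [hce, hcg5]
  simp only [Nat.cast_ofNat]
  intro χ heven hord hprim'
  haveI : NeZero (2 ^ (n + 2)) := ⟨pow_ne_zero _ two_ne_zero⟩
  haveI : NeZero (2 ^ n) := ⟨pow_ne_zero _ two_ne_zero⟩
  haveI hintΩ := isIntegral_genFib_baseChange 2 ((integralModelInt W).map (Int.castRingHom ℤ_[2]))
  have hcodd : ¬ (2 : ℤ) ∣ c := not_two_dvd_of_gcd_eq_one hgc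
  have hdodd : ¬ (2 : ℤ) ∣ dd := not_two_dvd_of_gcd_eq_one hgd
  have hcu : IsUnit ((c : ℤ) : ZMod (2 ^ (n + 2))) := isUnit_intCast_zmod_two_pow hcodd (n + 2)
  have hdu : IsUnit ((dd : ℤ) : ZMod (2 ^ (n + 2))) := isUnit_intCast_zmod_two_pow hdodd (n + 2)
  have hk0 := @toLoc_symm_plusPoint_mem_kernel W _ cc σσ d₀ (fun m ↦ (hcΩ m).2.1) hd₀ n
  obtain ⟨L, hLdef⟩ : ∃ L : ℕ → PadicAlgCl 2, L = fun j ↦ ptLogΩ 2 ((integralModelInt W).map (Int.castRingHom ℤ_[2]))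
      ((toLoc ((genFibΩ_eq_baseChange ((integralModelInt W).map (Int.castRingHom ℤ_[2]))).trans
        (baseChange_twoAdicModel W))).symm (g₀ ^ j • d₀ n)) := ⟨_, rfl⟩
  have hLj : ∀ j, L j = g₀ ^ j • ptLogΩ 2 ((integralModelInt W).map (Int.castRingHom ℤ_[2]))
      ((toLoc ((genFibΩ_eq_baseChange ((integralModelInt W).map (Int.castRingHom ℤ_[2]))).trans
        (baseChange_twoAdicModel W))).symm (d₀ n)) := fun j ↦ by
    rw [hLdef]; exact ptLogΩ_toLoc_symm_pow_smul W g₀ j (d₀ n) @hk0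
  have hL0 : L 0 = ptLogΩ 2 ((integralModelInt W).map (Int.castRingHom ℤ_[2]))
      ((toLoc ((genFibΩ_eq_baseChange ((integralModelInt W).map (Int.castRingHom ℤ_[2]))).trans
        (baseChange_twoAdicModel W))).symm (d₀ n)) := by rw [hLj, pow_zero, one_smul]
  have hLorb : ∀ j, L j = g₀ ^ j • L 0 := fun j ↦ by rw [hLj j, hL0]
  have hL0mem : L 0 ∈ layer 2 (n + 2) := by
    rw [hL0]; exact ptLogΩ_mem_layer W ι hκ n (d₀ n) (hd₀L n) @hk0
  have hLneg : ∀ a : ZMod (2 ^ (n + 2)), IsUnit a → τ (n + 2) (-a) • L 0 = τ (n + 2) a • L 0 := by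
    intro a ha; rw [hL0]; exact tau_neg_smul_ptLogΩ_eq W ι hκ n (τ (n + 2)) (hτ (n + 2)) ha (d₀ n) (hd₀L n) @hk0
  have hg₀1 : g₀ • zeta 2 (n + 2) = zeta 2 (n + 2) ^ 5 := by simpa using hζpow (n + 2) 1
  have hmemv : ∀ j : ℕ, g ^ j • d n ∈ localLayerPointsOfEmb κ (closureEmb (K := ℚ) (v.adicCompletion ℚ)) W n :=
    fun j ↦ smul_mem_localLayerPointsOfEmb κ (closureEmb (K := ℚ) (v.adicCompletion ℚ)) W n (g ^ j) (hL n)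
  obtain ⟨V, hVdef⟩ : ∃ V : ℕ → ℤ_[2], V = fun j ↦ pair n (I.proj n s) ⟨g ^ j • d n, hmemv j⟩ := ⟨_, rfl⟩
  have hpt : ∀ j : ℕ, (show localPoints W (v.adicCompletion ℚ) from
      WeierstrassCurve.Affine.Point.map (W' := W)
        (Φ : AlgebraicClosure ℚ_[2] →ₐ[ℚ] AlgebraicClosure (v.adicCompletion ℚ))
        (show (W.baseChange (AlgebraicClosure ℚ_[2])).toAffine.Point from (g₀ ^ j • d₀ n))) = g ^ j • d n := by
    intro j
    have h := hTg W j (d₀ n)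
    have h' := hdT n
    dsimp only at h h' ⊢
    rw [h, h']
  have hQv : ∀ j : ℕ, WeierstrassCurve.Affine.Point.map (W' := W)
        (Φ : AlgebraicClosure ℚ_[2] →ₐ[ℚ] AlgebraicClosure (v.adicCompletion ℚ))
        (show (W.baseChange (AlgebraicClosure ℚ_[2])).toAffine.Point from (g₀ ^ j • d₀ n)) ∈
      localLayerPointsOfEmb κ (closureEmb (K := ℚ) (v.adicCompletion ℚ)) W n := by
    intro j
    have h := hpt j
    dsimp only at h
    rw [h]
    exact hmemv j
  have hkj : ∀ j : ℕ, (toLoc ((genFibΩ_eq_baseChange ((integralModelInt W).map (Int.castRingHom ℤ_[2]))).trans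
      (baseChange_twoAdicModel W))).symm (g₀ ^ j • d₀ n) ∈
        kernel (Valued.v (R := PadicAlgCl 2)) (genFibΩ 2 ((integralModelInt W).map (Int.castRingHom ℤ_[2]))) :=
    fun j ↦ @toLoc_symm_smul_mem_kernel W _ (g₀ ^ j) (d₀ n) @hk0
  obtain ⟨xF, hxF⟩ : ∃ xF : CyclotomicField (cycLevel 2 (n + 2) (∅ : Finset (HeightOneSpectrum (𝓞 ℚ)))) ℚ,
      xF = x (n + 2) (cyclotomicLevelsRat 2 (badPlaces c dd (2 ^ ee) (W.conductorNorm ℤ))).idealOne := ⟨_, rfl⟩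
  have hV : ∀ j : ℕ, algebraMap ℚ_[2] (PadicAlgCl 2) (V j : ℚ_[2]) = ∑ b : (ZMod (2 ^ (n + 2)))ˣ, τ (n + 2) (b : ZMod (2 ^ (n + 2))) • (L j * e (n + 2) xF) := by
    intro j
    have h6 := hADJ n (g₀ ^ j • d₀ n) (hQv j) (@hkj j)
    have hproj : I.proj n s = levelToLayerTwo W hκ (∅ : Set (HeightOneSpectrum (𝓞 ℚ))) n
        (z (n + 2) (cyclotomicLevelsRat 2 (badPlaces c dd (2 ^ ee) (W.conductorNorm ℤ))).idealOne) := hs n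
    have hsub : (⟨g ^ j • d n, hmemv j⟩ : localLayerPointsOfEmb κ (closureEmb (K := ℚ) (v.adicCompletion ℚ)) W n) =
        ⟨_, hQv j⟩ := Subtype.ext (hpt j).symm
    rw [hVdef]
    dsimp only
    rw [hsub, hproj, h6, hLdef, hxF]
  have hB2inst := charSumF_mul_gaussSum_eq_two_of_valueLaw hf hC5 hq hcodd hdodd d' hdd' (hιC (n + 2))
  rw [← hxF] at hB2inst
  have hlogprim : ∀ ψ : DirichletCharacter (PadicAlgCl 2) (2 ^ (n + 2)), ψ (-1) = 1 → ψ.IsPrimitive →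
      ∑ j ∈ Finset.range (2 ^ n), ψ (5 : ZMod (2 ^ (n + 2))) ^ j * L j =
        3 * gaussSum ψ (AddChar.zmodChar (2 ^ (n + 2)) (HondaLog.zeta_pow_prime_pow_self (p := 2) (n + 2))) := by
    intro ψ hev hψ
    rw [hLdef]
    exact LocalVar.sum_pow_mul_ptLogΩ_pow_smul_plusHondaPoint_eq W hcΩ hcstab hσσ hd₀ n hg₀1 ψ hψ hev
  have hmain : (q.den : ℂ_[2]) * ∑ j ∈ Finset.range (2 ^ n),
        algebraMap (PadicAlgCl 2) ℂ_[2] (algebraMap ℚ_[2] (PadicAlgCl 2) (V j : ℚ_[2])) * χ (5 : ZMod (2 ^ (n + 2))) ^ j =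
      3 * (q.num : ℂ_[2]) *
        ((c : ℂ_[2]) ^ 2 * (dd : ℂ_[2]) ^ 2 * ((ratMinusSymbol f ((a : ℚ) / (2 ^ ee : ℕ)) : ℚ) : ℂ_[2])
          - (c : ℂ_[2]) * (dd : ℂ_[2]) ^ 2 * χ (c : ZMod (2 ^ (n + 2))) *
              ((ratMinusSymbol f ((a * c : ℚ) / (2 ^ ee : ℕ)) : ℚ) : ℂ_[2])
          - (c : ℂ_[2]) ^ 2 * (dd : ℂ_[2]) * χ (dd : ZMod (2 ^ (n + 2))) *
              ((ratMinusSymbol f ((a * d' : ℚ) / (2 ^ ee : ℕ)) : ℚ) : ℂ_[2])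
          + (c : ℂ_[2]) * (dd : ℂ_[2]) * (χ (c : ZMod (2 ^ (n + 2))) * χ (dd : ZMod (2 ^ (n + 2)))) *
              ((ratMinusSymbol f ((a * c * d' : ℚ) / (2 ^ ee : ℕ)) : ℚ) : ℂ_[2])) *
        ratTwistedSymbolSum f χ := by
    by_cases hp : χ.IsPrimitive
    · exact level_identity_primitive f n (cycLevel_two_empty (n + 2)) (e (n + 2)) (he (n + 2)) (τ (n + 2)) (hτ (n + 2))
        (hζpow (n + 2)) L hLorb hL0mem hLneg xF V hV q c dd _ _ _ _ hB2inst hlogprim χ heven hp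
    · have hn : n ≤ 1 := hprim'.resolve_left hp
      have h1 : χ = 1 := eq_one_of_even_of_not_isPrimitive hn χ heven hp
      subst h1
      have hlog := hB4b W hcΩ hσσ hd₀ n hn hg₀1
      have hB4c' := katoTrivialValuesTwo_brick_of_valueLaw W hss ha f hf hC5 hq (rfl : (2 ^ ee : ℕ) = 2 ^ ee) d' hdd' (n + 2)
        (by omega) (by omega)
        (gcd_mul_cycLevel_mul_pow_eq_one hcodd hdodd (n + 2) ee)
      obtain ⟨hH0, hH1⟩ := hB4a f hf0 hQ hN2 hap
      have hH : ratTwistedSymbolSum f (1 : DirichletCharacter ℂ_[2] (2 ^ (n + 2))) =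
          (((if n = 0 then (-1 : ℚ) else 4) * ratPlusSymbol f 0 : ℚ) : ℂ_[2]) := by
        interval_cases n
        · rw [hH0]; push_cast; ring
        · rw [hH1]; push_cast; ring
      refine level_identity_trivial f n (cycLevel_two_empty (n + 2)) (e (n + 2)) (he (n + 2)) (τ (n + 2)) (hτ (n + 2))
        (hζpow (n + 2)) L hLorb hL0mem hLneg xF V hV q c dd hcu hdu (ratPlusSymbol f 0) _ _ _ _
        (if n = 0 then (-2 : ℚ) else 8) (if n = 0 then (-1 : ℚ) else 4) (by split_ifs <;> norm_num) ?_ ?_ hH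
      · rw [hLdef]; exact hlog
      · rw [hxF]; exact hB4c'
  have hz : ‖χ (5 : ZMod (2 ^ (n + 2))) - 1‖ < 1 := by
    have h := Literature.NumberTheory.EllipticCurves.norm_apply_cyclotomicGenerator_sub_one_lt χ hord
    simpa only [hcg5, Nat.cast_ofNat] using h
  have hν := hasSum_cpCoeff_C (((D * q.den : ℤ) : ℤ_[2])) (χ (5 : ZMod (2 ^ (n + 2))) - 1)
  have hμ := hasSum_cpCoeff_mul hz (hasSum_cpCoeff_C (((3 * q.num : ℤ) : ℤ_[2])) (χ (5 : ZMod (2 ^ (n + 2))) - 1))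
    (hμteval n χ heven hord)
  rw [hν.tsum_eq, hμ.tsum_eq, CoreChi.tsum_coeff_pairingSum_mul_pow_eq_sum]
  have hsum : ∑ j ∈ Finset.range (2 ^ n), ((algebraMap ℚ_[2] ℂ_[2]).comp (algebraMap ℤ_[2] ℚ_[2]))
        (evalOn W (localLayerPointsOfEmb κ (closureEmb (K := ℚ) (v.adicCompletion ℚ)) W n) (pair n (I.proj n s)) (g ^ j • d n)) *
          χ (5 : ZMod (2 ^ (n + 2))) ^ j =
      ∑ j ∈ Finset.range (2 ^ n),
        algebraMap (PadicAlgCl 2) ℂ_[2] (algebraMap ℚ_[2] (PadicAlgCl 2) (V j : ℚ_[2])) * χ (5 : ZMod (2 ^ (n + 2))) ^ j := by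
    refine Finset.sum_congr rfl fun j _ ↦ ?_
    rw [evalOn_of_mem (hP := hmemv j), hVdef, RingHom.comp_apply, IsScalarTower.algebraMap_apply ℚ_[2] (PadicAlgCl 2) ℂ_[2]]
    rfl
  rw [hsum, map_intCast, map_intCast]
  simp only [Int.cast_mul, Int.cast_ofNat, Int.cast_natCast]
  linear_combination (D : ℂ_[2]) * hmain

end Summit.BirchSwinnertonDyer.BirchSwinnertonDyer.Theorems.SignedKatoOffTwo.KatoBK

end
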